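import Summits.Ventures.HodgeRepro2.T5SU11RadialGreenKernel
import Summits.Ventures.HodgeRepro2.T5SU11SphericalGreenEdge

/-!
# The resolvent is a symmetric operator in `L²(sinh 2t dt)`: `⟨G f, h⟩ = ⟨f, G h⟩`

The Green's kernel `K(t, s) = −φ(min(t, s)) χ(max(t, s))` of row 461 is symmetric, so the Green's operator
`(G f)(t) = ∫_a^b K(t, s) f(s) sinh 2s ds` is symmetric for the pairing `⟨u, v⟩ = ∫ u v sinh 2t dt`: for two
continuous sources `f`, `h` supported in `[a, b] ⊂ (0, ∞)`,

  **`∫_a^b (G f)(t) h(t) sinh 2t dt = ∫_a^b f(s) (G h)(s) sinh 2s ds`**  (`greenSol_symm`),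

by Fubini on the compact rectangle `[a, b]²` (`integral_integral_swap`; the double integrand is continuous on the
closed rectangle, `continuousOn_kernel_integrand`, hence integrable for the product of the restricted Lebesgue
measures, `integrable_kernel_integrand`) and `K(t, s) = K(s, t)`. For the explicit model: **`⟨G_λ f, h⟩ = ⟨f, G_λ h⟩`**
at `λ > 1` (`sphGreen_symm`) and at the edge `λ = 1` (`sphGreen_one_symm`), also in the form of the pairing over all of
`(0, ∞)` (`sphGreen_symm_Ioi`) — the resolvent `(L − λ(λ−2))⁻¹` of the radial Laplacian is a symmetric (and, by row
465, negative) operator on compactly supported sources in `L²((0, ∞), sinh 2t dt)`. Nothing is claimed about (N).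

Blind lane: Mathlib + the HodgeRepro2 prefix only; no sorry; axioms ⊆ {propext, Classical.choice,
Quot.sound}.
-/

namespace Summit.Ventures.HodgeRepro2.T5SU11RadialGreenSymmetric

open MeasureTheory intervalIntegral
open Set (Ioi Ioc Icc)
open T5SU11Cartan T5SU11SphericalFunction T5SU11ReductionOfOrder T5SU11SphericalSolutionSpaceAll
  T5SU11SphericalDecay T5SU11SphericalDecayEdge T5SU11RadialGreen T5SU11SphericalGreen T5SU11RadialGreenKernel

section

variable {a b : ℝ} {φ φ' χ χ' f h : ℝ → ℝ}
  (hφ : ∀ t, 0 < t → HasDerivAt φ (φ' t) t) (hχ : ∀ t, 0 < t → HasDerivAt χ (χ' t) t)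
  (hf : ContinuousOn f (Ioi 0)) (hh : ContinuousOn h (Ioi 0)) (ha : 0 < a) (hab : a ≤ b)

include hφ hχ in
/-- The Green's kernel is continuous on `(0, ∞)²`. -/
theorem continuousOn_greenKernel :
    ContinuousOn (fun p : ℝ × ℝ => greenKernel φ χ p.1 p.2) (Ioi 0 ×ˢ Ioi 0) := by
  have hcφ : ContinuousOn φ (Ioi 0) := fun t ht => (hφ t ht).continuousAt.continuousWithinAt
  have hcχ : ContinuousOn χ (Ioi 0) := fun t ht => (hχ t ht).continuousAt.continuousWithinAt
  have hmin : ContinuousOn (fun p : ℝ × ℝ => min p.1 p.2) (Ioi 0 ×ˢ Ioi 0) :=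
    (continuous_fst.min continuous_snd).continuousOn
  have hmax : ContinuousOn (fun p : ℝ × ℝ => max p.1 p.2) (Ioi 0 ×ˢ Ioi 0) :=
    (continuous_fst.max continuous_snd).continuousOn
  have h1 : ContinuousOn (fun p : ℝ × ℝ => φ (min p.1 p.2)) (Ioi 0 ×ˢ Ioi 0) :=
    hcφ.comp hmin (fun p hp => Set.mem_Ioi.mpr (lt_min hp.1 hp.2))
  have h2 : ContinuousOn (fun p : ℝ × ℝ => χ (max p.1 p.2)) (Ioi 0 ×ˢ Ioi 0) :=
    hcχ.comp hmax (fun p hp => Set.mem_Ioi.mpr (lt_max_of_lt_left hp.1))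
  exact (h1.mul h2).neg

include hφ hχ hf hh ha in
/-- The double integrand `K(t, s) f(s) sinh 2s · h(t) sinh 2t` is continuous on the closed rectangle `[a, b]²`. -/
theorem continuousOn_kernel_integrand :
    ContinuousOn (fun p : ℝ × ℝ => greenKernel φ χ p.1 p.2 * f p.2 * Real.sinh (2 * p.2)
      * (h p.1 * Real.sinh (2 * p.1))) (Icc a b ×ˢ Icc a b) := by
  have hsub : Icc a b ×ˢ Icc a b ⊆ Ioi 0 ×ˢ Ioi 0 :=
    Set.prod_mono (fun t ht => lt_of_lt_of_le ha ht.1) (fun t ht => lt_of_lt_of_le ha ht.1)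
  have hK := (continuousOn_greenKernel hφ hχ).mono hsub
  have hf2 : ContinuousOn (fun p : ℝ × ℝ => f p.2) (Icc a b ×ˢ Icc a b) :=
    hf.comp continuous_snd.continuousOn (fun p hp => lt_of_lt_of_le ha hp.2.1)
  have hh1 : ContinuousOn (fun p : ℝ × ℝ => h p.1) (Icc a b ×ˢ Icc a b) :=
    hh.comp continuous_fst.continuousOn (fun p hp => lt_of_lt_of_le ha hp.1.1)
  have hs2 : Continuous (fun p : ℝ × ℝ => Real.sinh (2 * p.2)) :=
    Real.continuous_sinh.comp (continuous_const.mul continuous_snd)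
  have hs1 : Continuous (fun p : ℝ × ℝ => Real.sinh (2 * p.1)) :=
    Real.continuous_sinh.comp (continuous_const.mul continuous_fst)
  exact ((hK.mul hf2).mul hs2.continuousOn).mul (hh1.mul hs1.continuousOn)

include hφ hχ hf hh ha in
/-- The double integrand is integrable for the product of the Lebesgue measures restricted to `(a, b]`. -/
theorem integrable_kernel_integrand :
    Integrable (fun p : ℝ × ℝ => greenKernel φ χ p.1 p.2 * f p.2 * Real.sinh (2 * p.2)
      * (h p.1 * Real.sinh (2 * p.1))) ((volume.restrict (Ioc a b)).prod (volume.restrict (Ioc a b))) := by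
  rw [Measure.prod_restrict]
  exact ((continuousOn_kernel_integrand hφ hχ hf hh ha).integrableOn_compact
    (isCompact_Icc.prod isCompact_Icc)).mono_set
    (Set.prod_mono Set.Ioc_subset_Icc_self Set.Ioc_subset_Icc_self)

include hφ hχ hf hh ha hab in
/-- **The Green's operator is symmetric**: `∫_a^b (G f) h sinh 2t = ∫_a^b f (G h) sinh 2s`. -/
theorem greenSol_symm :
    ∫ t in a..b, greenSol φ χ f a b t * h t * Real.sinh (2 * t)
      = ∫ s in a..b, f s * greenSol φ χ h a b s * Real.sinh (2 * s) := by
  -- both sides as iterated integrals over `(a, b]²`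
  have hL : ∫ t in a..b, greenSol φ χ f a b t * h t * Real.sinh (2 * t)
      = ∫ t in Ioc a b, ∫ s in Ioc a b,
          greenKernel φ χ t s * f s * Real.sinh (2 * s) * (h t * Real.sinh (2 * t)) := by
    rw [integral_of_le hab]
    refine setIntegral_congr_fun measurableSet_Ioc (fun t ht => ?_)
    rw [greenSol_eq_integral_kernel hφ hχ hf ha ht.1.le ht.2, integral_of_le hab, mul_assoc,
      ← MeasureTheory.integral_mul_const]
  have hR : ∫ s in a..b, f s * greenSol φ χ h a b s * Real.sinh (2 * s)
      = ∫ s in Ioc a b, ∫ t in Ioc a b,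
          greenKernel φ χ t s * f s * Real.sinh (2 * s) * (h t * Real.sinh (2 * t)) := by
    rw [integral_of_le hab]
    refine setIntegral_congr_fun measurableSet_Ioc (fun s hs => ?_)
    rw [greenSol_eq_integral_kernel hφ hχ hh ha hs.1.le hs.2, integral_of_le hab]
    have : ∫ t in Ioc a b, greenKernel φ χ t s * f s * Real.sinh (2 * s) * (h t * Real.sinh (2 * t))
        = ∫ t in Ioc a b, (greenKernel φ χ s t * h t * Real.sinh (2 * t)) * (f s * Real.sinh (2 * s)) := by
      refine setIntegral_congr_fun measurableSet_Ioc (fun t _ => ?_)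
      rw [greenKernel_symm]
      ring
    rw [this, MeasureTheory.integral_mul_const]
    ring
  rw [hL, hR]
  exact integral_integral_swap (integrable_kernel_integrand hφ hχ hf hh ha)

/-- For a source `h` supported in `[a, b]`, the pairing over `(0, ∞)` is the pairing over `[a, b]`. -/
theorem integral_Ioi_mul_eq_intervalIntegral {a b : ℝ} {u h : ℝ → ℝ} (ha : 0 < a) (hab : a ≤ b)
    (hha : ∀ s, s ≤ a → h s = 0) (hhb : ∀ s, b ≤ s → h s = 0) :
    ∫ t in Ioi 0, u t * h t * Real.sinh (2 * t) = ∫ t in a..b, u t * h t * Real.sinh (2 * t) := by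
  rw [integral_of_le hab]
  refine setIntegral_eq_of_subset_of_forall_sdiff_eq_zero measurableSet_Ioi
    (fun t ht => lt_of_lt_of_le ha ht.1.le) ?_
  intro t ht
  rcases le_or_gt t a with h' | h'
  · simp only [hha t h', mul_zero, zero_mul]
  · have hbt : b < t := by
      by_contra hc
      exact ht.2 ⟨h', not_lt.mp hc⟩
    simp only [hhb t hbt.le, mul_zero, zero_mul]

end

section measure

variable [MeasurableSpace Circle] [BorelSpace Circle]

/-- **The resolvent at `λ > 1` is symmetric**: `∫_a^b (G_λ f) h sinh 2t = ∫_a^b f (G_λ h) sinh 2s`. -/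
theorem sphGreen_symm {lam a b : ℝ} {f h : ℝ → ℝ} (hlam : 1 < lam) (hf : ContinuousOn f (Ioi 0))
    (hh : ContinuousOn h (Ioi 0)) (ha : 0 < a) (hab : a ≤ b) :
    ∫ t in a..b, sphGreen lam f a b t * h t * Real.sinh (2 * t)
      = ∫ s in a..b, f s * sphGreen lam h a b s * Real.sinh (2 * s) :=
  greenSol_symm (hφ_sph lam) (fun _ ht => hasDerivAt_sphDecay hlam ht) hf hh ha hab

/-- **The resolvent at the edge `λ = 1` is symmetric.** -/
theorem sphGreen_one_symm {a b : ℝ} {f h : ℝ → ℝ} (hf : ContinuousOn f (Ioi 0))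
    (hh : ContinuousOn h (Ioi 0)) (ha : 0 < a) (hab : a ≤ b) :
    ∫ t in a..b, sphGreen 1 f a b t * h t * Real.sinh (2 * t)
      = ∫ s in a..b, f s * sphGreen 1 h a b s * Real.sinh (2 * s) :=
  greenSol_symm (hφ_sph 1) (fun _ ht => hasDerivAt_sphDecay_one ht) hf hh ha hab

/-- **`⟨G_λ f, h⟩ = ⟨f, G_λ h⟩` in `L²((0, ∞), sinh 2t dt)`** for two continuous sources supported in `[a, b]`. -/
theorem sphGreen_symm_Ioi {lam a b : ℝ} {f h : ℝ → ℝ} (hlam : 1 < lam) (hf : ContinuousOn f (Ioi 0))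
    (hh : ContinuousOn h (Ioi 0)) (ha : 0 < a) (hab : a ≤ b) (hfa : ∀ s, s ≤ a → f s = 0)
    (hfb : ∀ s, b ≤ s → f s = 0) (hha : ∀ s, s ≤ a → h s = 0) (hhb : ∀ s, b ≤ s → h s = 0) :
    ∫ t in Ioi 0, sphGreen lam f a b t * h t * Real.sinh (2 * t)
      = ∫ s in Ioi 0, f s * sphGreen lam h a b s * Real.sinh (2 * s) := by
  rw [integral_Ioi_mul_eq_intervalIntegral ha hab hha hhb, sphGreen_symm hlam hf hh ha hab]
  have : ∫ s in Ioi 0, f s * sphGreen lam h a b s * Real.sinh (2 * s)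
      = ∫ s in Ioi 0, sphGreen lam h a b s * f s * Real.sinh (2 * s) := by
    congr 1
    funext s
    ring
  rw [this, integral_Ioi_mul_eq_intervalIntegral ha hab hfa hfb]
  congr 1
  funext s
  ring

end measure

end Summit.Ventures.HodgeRepro2.T5SU11RadialGreenSymmetric
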